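import Literature.NumberTheory.ComplexMultiplication.CMTypeSpecialElementReflexField
import HarnessLib

/-!
# CM types with a special element (unitary signature `(n − 1, 1)` over an imaginary quadratic subfield) are
# NONDEGENERATE: Dodson's constant weight criterion at weight one; the Hodge conjecture for all powers of the
# corresponding CM abelian varieties

Layer `Literature/NumberTheory/ComplexMultiplication`, namespace `Literature.NumberTheory.ComplexMultiplication` (lane
`lit-hodgefound`, Track 2 foundations, Layer A3; seat `lit-hodgefound-p11`, generation 25, row g25-#7).  Sequel of
`CMTypeSpecialElementReflexField` (g25-#6) and of the tree's `ConstantWeightCriterionQuadraticSubfield` (Dodson's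
criterion in the printed generality).  THEOREMS ONLY: no definition, no named fact (D-0026), net Literature debt 0.

THE PRINT.  B. Dodson, *The structure of Galois groups of CM-fields*, Trans. AMS 283 (1984) [Dodson1984], §3.1.1
THEOREM (held `paper:doi-10-2307-1999987`, pp. 11–12), the «constant weight criterion»:

> «Suppose the CM-field `K` has an imaginary quadratic subfield, and let `G₀ = Gal(K₀ᶜ/ℚ)` be given by `G₀ ⊂ Sₙ`.
> […] Let `Φ = Φᶠ`, `f ∈ (ℤ₂)ⁿ`, be a CM-type on `K` and let `r` be the rank of the `ℤ`-span of the orbit `G₀*(f)`,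
> regarded as a subset of `ℤⁿ`.  Then `t(Φ) = r + 1`, unless the weight of `f` is `n/2`, in which case `t(Φ) = r`
> may also occur.»

applied at WEIGHT ONE: a CM type `Φ` with a special element `σ₀` over the imaginary quadratic subfield `k₀` (Howard
2012 §3.1 [Howard2012]: «there is a unique `φ^sp ∈ Φ` whose restriction to `K₀` is `ῑ`»; g25-#6) deviates from the
type `E₀` induced from `ῑ = \overline{σ₀|_{k₀}}` exactly at `f = E₀ ∖ Φ = {σ̄₀}`, a vector of weight `|f| = 1`; the
`G₀`-orbit of a coordinate vector is the whole standard basis of `ℤⁿ` (`G₀` is transitive on the `n` embeddings above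
`ῑ`), so `r = n`, and `1 ≠ n/2` once `n ≥ 3`: **`t(Φ) = n + 1`, i.e. `Φ` is NONDEGENERATE** (`[K : ℚ] = 2n ≥ 6`).
By Pohlmann–Hazama–Murty (tree `Pohlmann1968.IsNondegenerate.hodgeConjectureFor_pow`, unconditional) every power of
every CM abelian variety of such a type satisfies the Hodge conjecture.

WHAT IS PROVED (all `sorry`-free).

§1 (group level: `G` acting transitively on a finite `E`, `ρ ∈ G`, a block `E₀` with `IsCMTypeWith ρ E₀` and
   `gE₀ ∈ {E₀, ρE₀}`) `translateInd_singleton` (`𝟙[g · ∈ {x₀}] = δ_{g⁻¹x₀}`), **`IsCMTypeWith.typeRank_stabilizer_singleton`: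
   the Kubota–Dodson rank of a singleton `{x₀} ⊆ E₀` under `G₀ = Stab(E₀)` is `|E₀|`** (Dodson's `r = n` at weight one).
§2 (CM field `K ⊇ k₀`, `[K : ℚ] ≥ 6`, `σ₀` special) `exists_cmType_singleton` (the CM type `{ψ}` of `k₀`),
   `sdiff_eq_singleton_of_special` (`E₀ ∖ Φ = {σ̄₀}`), **`cmTypeRank_eq_of_special`: `Rank(Φ) = [K : ℚ]/2 + 1`**,
   **`isNondegenerate_of_special`**; octic corollary `cmTypeRank_eq_five_of_special_octic` (sharpening g25-#6's
   `Rank ∈ {4, 5}`); sextic: the known `isNondegenerate_iff_isPrimitive_sextic` re-derived through special elements.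
§3 **`hodgeConjectureFor_pow_of_special` / `hodgeConjectureFor_of_special`: the Hodge conjecture for every power of
   every realisation `(A, ι, θ)` of a CM type with a special element** (`[K : ℚ] ≥ 6`), unconditional.

## References

* [Dodson1984] B. Dodson, Trans. AMS 283 (1984), §3.1.1 Theorem and proof (pp. 11–12).
* [Howard2012] B. Howard, Ann. of Math. (2) 176 (2012), §3.1.
* [Gordon1999HodgeAVSurvey] B. B. Gordon, *A survey of the Hodge conjecture for abelian varieties*, §9.3–9.4, Thm. 6.4.
* [Yanai1985] H. Yanai, Remark (p. 172).

## Provenance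

Lane `lit-hodgefound` (HOME `run/shared/lean/pub/lit-hodgefound/`), prover seat `lit-hodgefound-p11` (gen 25),
self-proposed row g25-#7 (INBOX claim 2026-08-27, l.41058).
-/

set_option autoImplicit false

noncomputable section

open scoped Classical NumberField Pointwise
open NumberField Module IntermediateField

namespace Literature.NumberTheory.ComplexMultiplication

/-! ## §1 Group level: the rank of a singleton under the stabiliser of a block -/

section GroupLevel

variable {G : Type*} [Group G] {E : Type*} [MulAction G E]

/-- `𝟙[g · ∈ {x₀}] = δ_{g⁻¹x₀}`: the indicator of the translate of a singleton is a coordinate vector.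
[cite: Dodson1984, §3.1.1 Theorem (proof)] -/
theorem translateInd_singleton (x₀ : E) (g : G) :
    translateInd ({x₀} : Set E) g = Pi.single (g⁻¹ • x₀) (1 : ℚ) := by
  funext x
  by_cases h : g • x = x₀
  · have hx : x = g⁻¹ • x₀ := by rw [← h, inv_smul_smul]
    rw [translateInd, if_pos (Set.mem_singleton_iff.2 h), hx, Pi.single_eq_same]
  · have hx : x ≠ g⁻¹ • x₀ := fun hx => h (by rw [hx, smul_inv_smul])
    rw [translateInd, if_neg (fun h' => h (Set.mem_singleton_iff.1 h')), Pi.single_eq_of_ne hx]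

namespace IsCMTypeWith

variable {ρ : G} {E₀ : Set E}

/-- `G₀ = Stab(E₀)` is transitive on the block `E₀` (as `G` is transitive on `E` and `gE₀ ∈ {E₀, ρE₀}`,
`E₀ ∩ ρE₀ = ∅`). [cite: Dodson1984, §3.1.1 Theorem (proof)] -/
theorem exists_mem_stabilizer_smul_eq_of_mem [MulAction.IsPretransitive G E] (h₀ : IsCMTypeWith ρ E₀)
    (hG : ∀ g : G, g • E₀ = E₀ ∨ g • E₀ = ρ • E₀) {x y : E} (hx : x ∈ E₀) (hy : y ∈ E₀) :
    ∃ m ∈ MulAction.stabilizer G E₀, m • x = y := by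
  obtain ⟨g, rfl⟩ := MulAction.exists_smul_eq G x y
  refine ⟨g, ?_, rfl⟩
  rcases hG g with h1 | h1
  · exact h1
  · exfalso
    have hgx : g • x ∈ ρ • E₀ := by
      rw [← h1]
      exact Set.smul_mem_smul_set hx
    obtain ⟨z, hz, hzx⟩ := hgx
    have hzx' : ρ • z = g • x := hzx
    rw [← hzx'] at hy
    exact (h₀.mem_iff z).1 hz hy

/-- **Dodson's `r` at weight one: the rank of the `G₀`-translates of a singleton `{x₀} ⊆ E₀` is `n = |E₀|`** — the
translates `𝟙[m · ∈ {x₀}]`, `m ∈ G₀ = Stab(E₀)`, are exactly the coordinate vectors `δ_e`, `e ∈ E₀` (`G₀` is transitive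
on `E₀`), which are linearly independent. [cite: Dodson1984, §3.1.1 Theorem] -/
theorem typeRank_stabilizer_singleton [Fintype E] [MulAction.IsPretransitive G E] (h₀ : IsCMTypeWith ρ E₀)
    (hG : ∀ g : G, g • E₀ = E₀ ∨ g • E₀ = ρ • E₀) {x₀ : E} (hx₀ : x₀ ∈ E₀) :
    typeRank (MulAction.stabilizer G E₀) ({x₀} : Set E) = E₀.ncard := by
  classical
  rw [typeRank_stabilizer_eq (E₀ := E₀) ({x₀} : Set E)]
  have hrange : Set.range (fun m : MulAction.stabilizer G E₀ => translateInd ({x₀} : Set E) (m : G)) =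
      Set.range (fun e : E₀ => (Pi.single (e : E) (1 : ℚ) : E → ℚ)) := by
    ext v
    constructor
    · rintro ⟨m, rfl⟩
      have hm : (m : G)⁻¹ • x₀ ∈ E₀ := by
        have h := MulAction.mem_stabilizer_iff.1 (m⁻¹).2
        rw [Subgroup.coe_inv] at h
        have h' := Set.smul_mem_smul_set (a := (m : G)⁻¹) hx₀
        rwa [h] at h'
      exact ⟨⟨_, hm⟩, (translateInd_singleton x₀ (m : G)).symm⟩
    · rintro ⟨e, rfl⟩
      obtain ⟨m, hm, hme⟩ := h₀.exists_mem_stabilizer_smul_eq_of_mem hG e.2 hx₀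
      refine ⟨⟨m, hm⟩, ?_⟩
      change translateInd ({x₀} : Set E) m = Pi.single (e : E) 1
      rw [translateInd_singleton, ← hme, inv_smul_smul]
  have hli : LinearIndependent ℚ (fun e : E₀ => (Pi.single (e : E) (1 : ℚ) : E → ℚ)) := by
    have h := (Pi.basisFun ℚ E).linearIndependent.comp (fun e : E₀ => (e : E)) Subtype.val_injective
    convert h using 1
    funext e
    simp [Pi.basisFun_apply]
  rw [hrange, finrank_span_eq_card hli, ← Nat.card_coe_set_eq, Nat.card_eq_fintype_card]

end IsCMTypeWith

end GroupLevel

/-! ## §2 CM types with a special element are nondegenerate -/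

section NumberField

open Literature.AlgebraicGeometry.Motives (CMType)
open Literature.AlgebraicGeometry.Motives.HodgeStructure (two_mul_ncard_cmType_eq_finrank)
open Literature.AlgebraicGeometry.Pohlmann1968 (cmTypeRank IsNondegenerate isNondegenerate_iff)
open Literature.AlgebraicGeometry (GaoUllmo2025.galoisClosure GaoUllmo2025.corestrict)

variable {K : Type} [Field K] [NumberField K] [IsCMField K] (k₀ : IntermediateField ℚ K) [IsTotallyComplex k₀]

omit [IsCMField K] in
/-- The CM type `{ψ}` of the imaginary quadratic field `k₀` (every embedding of `k₀` is `ψ` or `ψ̄ ≠ ψ`).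
[cite: Shimura1998, §8.4 (1)] -/
theorem exists_cmType_singleton (hk₀ : finrank ℚ k₀ = 2) (ψ : k₀ →+* ℂ) : ∃ Ψ₀ : CMType k₀, Ψ₀.1 = {ψ} := by
  haveI : NumberField k₀ := NumberField.mk
  have hne : ComplexEmbedding.conjugate ψ ≠ ψ := fun h =>
    IsTotallyComplex.complexEmbedding_not_isReal ψ (ComplexEmbedding.isReal_iff.2 h)
  have htwo : ∀ χ : k₀ →+* ℂ, χ = ψ ∨ χ = ComplexEmbedding.conjugate ψ := fun χ => by
    have hcard : ({ψ, ComplexEmbedding.conjugate ψ} : Finset (k₀ →+* ℂ)).card = Fintype.card (k₀ →+* ℂ) := by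
      rw [Finset.card_pair hne.symm, Embeddings.card, hk₀]
    have hχ : χ ∈ ({ψ, ComplexEmbedding.conjugate ψ} : Finset (k₀ →+* ℂ)) := by
      rw [Finset.eq_univ_of_card _ hcard]
      exact Finset.mem_univ χ
    simpa only [Finset.mem_insert, Finset.mem_singleton] using hχ
  refine ⟨⟨{ψ}, fun χ => ?_⟩, rfl⟩
  rw [Set.mem_singleton_iff, Set.mem_singleton_iff]
  constructor
  · rintro rfl
    exact hne
  · intro h
    rcases htwo χ with h' | h'
    · exact h'
    · exfalso
      apply h
      rw [h']
      exact ComplexEmbedding.involutive_conjugate _ ψ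

omit [IsCMField K] in
/-- **Weight one: `E₀ ∖ Φ = {σ̄₀}`** — a CM type with special element `σ₀` deviates from the type `E₀` induced from
`ῑ = \overline{σ₀|_{k₀}}` (all embeddings above `ῑ`) exactly at `σ̄₀` (Dodson's `f ∈ (ℤ₂)ⁿ` has weight `1`).
[cite: Dodson1984, §3.1.1 Theorem] [cite: Howard2012, §3.1] -/
theorem sdiff_eq_singleton_of_special (hk₀ : finrank ℚ k₀ = 2) {Φ : CMType K} {σ₀ : K →+* ℂ} (hσ₀ : σ₀ ∈ Φ.1)
    (hsp : ∀ φ ∈ Φ.1, φ.comp (algebraMap k₀ K) = σ₀.comp (algebraMap k₀ K) → φ = σ₀) {Φ₀ : CMType K}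
    (hΦ₀ : ∀ φ : K →+* ℂ, φ ∈ Φ₀.1 ↔
      φ.comp (algebraMap k₀ K) = ComplexEmbedding.conjugate (σ₀.comp (algebraMap k₀ K))) :
    Φ₀.1 \ Φ.1 = {ComplexEmbedding.conjugate σ₀} := by
  ext φ
  rw [Set.mem_sdiff, hΦ₀, Set.mem_singleton_iff]
  constructor
  · rintro ⟨hres, hφ⟩
    by_contra hne
    exact hφ (mem_of_comp_eq_conjugate_of_ne_special k₀ hk₀ hσ₀ hsp hres hne)
  · rintro rfl
    exact ⟨(conjugate_comp_ringHom (algebraMap k₀ K) σ₀).symm, (Φ.2 σ₀).1 hσ₀⟩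

/-- **A CM TYPE WITH A SPECIAL ELEMENT IS NONDEGENERATE: `Rank(Φ) = [K : ℚ]/2 + 1`** (`[K : ℚ] ≥ 6`).  Dodson's
constant weight criterion `t(Φ) = r + 1` (tree `cmTypeRank_eq_typeRank_stabilizer_add_one`, read in the Galois model
`L = K^{gal} ⊂ ℂ`) with `E₀` the type induced from `ῑ` (reflex degree `2`), `f = E₀ ∖ Φ = {σ̄₀}` of weight
`1 ∉ {0, n/2}`, and `r = n` (`typeRank_stabilizer_singleton`). [cite: Dodson1984, §3.1.1 Theorem] [cite: Howard2012, §3.1] -/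
theorem cmTypeRank_eq_of_special (hk₀ : finrank ℚ k₀ = 2) (h6 : 6 ≤ finrank ℚ K) {Φ : CMType K} {σ₀ : K →+* ℂ}
    (hσ₀ : σ₀ ∈ Φ.1) (hsp : ∀ φ ∈ Φ.1, φ.comp (algebraMap k₀ K) = σ₀.comp (algebraMap k₀ K) → φ = σ₀) :
    cmTypeRank Φ = finrank ℚ K / 2 + 1 := by
  classical
  -- the Galois model `L ⊂ ℂ`
  let Lc := GaoUllmo2025.galoisClosure K
  let j : K →ₐ[ℚ] Lc := GaoUllmo2025.corestrict K σ₀.toRatAlgHom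
  let ι : Lc →+* ℂ := algebraMap Lc ℂ
  -- the type `Φ₀ = E₀` induced from `{ῑ}`, `ῑ = conj (σ₀|k₀)`
  obtain ⟨Ψ₀, hΨ₀⟩ := exists_cmType_singleton k₀ hk₀ (ComplexEmbedding.conjugate (σ₀.comp (algebraMap k₀ K)))
  let Φ₀ : CMType K := inducedCMType (algebraMap k₀ K) Ψ₀
  have hΦ₀ : ∀ φ : K →+* ℂ, φ ∈ Φ₀.1 ↔
      φ.comp (algebraMap k₀ K) = ComplexEmbedding.conjugate (σ₀.comp (algebraMap k₀ K)) := fun φ => by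
    change φ.comp (algebraMap k₀ K) ∈ Ψ₀.1 ↔ _
    rw [hΨ₀, Set.mem_singleton_iff]
  have hdiff : Φ₀.1 \ Φ.1 = {ComplexEmbedding.conjugate σ₀} := sdiff_eq_singleton_of_special k₀ hk₀ hσ₀ hsp hΦ₀
  -- `[K'(Φ₀) : ℚ] = 2`
  have h2 : finrank ℚ (reflexField ℚ Lc (algValuedIn ι Φ₀.1)) = 2 := by
    rw [← finrank_traceField_eq_finrank_reflexField j ι Φ₀]
    exact finrank_traceField_inducedCMType_quadratic k₀ hk₀ Ψ₀
  -- the weight `|f| = 1 ∉ {0, n/2}`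
  have hg := two_mul_ncard_cmType_eq_finrank Φ
  have hw : 2 * (Φ₀.1 \ Φ.1).ncard ≠ finrank ℚ K / 2 := by
    rw [hdiff, Set.ncard_singleton]
    omega
  have hw0 : ¬ Φ₀.1 ⊆ Φ.1 := fun h =>
    (Φ.2 σ₀).1 hσ₀ (h ((hΦ₀ _).2 (conjugate_comp_ringHom (algebraMap k₀ K) σ₀).symm))
  -- Dodson's criterion: `t(Φ) = r + 1`
  have hcrit := cmTypeRank_eq_typeRank_stabilizer_add_one j ι Φ₀ Φ h2 hw hw0
  -- the block `E₀` read in `Hom_ℚ(K, L)` and the singleton `f`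
  have h₀ : IsCMTypeWith (conjGal : Lc ≃ₐ[ℚ] Lc) (algValuedIn ι Φ₀.1) := isCMTypeWith_conjGal_algValuedIn ι Φ₀
  haveI : Nonempty (K →ₐ[ℚ] Lc) := ⟨j⟩
  have horb : (MulAction.orbit (Lc ≃ₐ[ℚ] Lc) (algValuedIn ι Φ₀.1)).ncard = 2 := by
    rw [← Nat.card_coe_set_eq, ← finrank_reflexField_eq_card_orbit, h2]
  have hG := h₀.smul_eq_or_of_ncard_orbit_eq_two horb
  let χ₀ : K →ₐ[ℚ] Lc := (algHomEquivRingHomOfNormal j ι).symm (ComplexEmbedding.conjugate σ₀)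
  have hχ₀ : ι.comp (χ₀ : K →+* Lc) = ComplexEmbedding.conjugate σ₀ := by
    change algHomEquivRingHomOfNormal j ι χ₀ = _
    exact (algHomEquivRingHomOfNormal j ι).apply_symm_apply _
  have hsing : algValuedIn ι Φ₀.1 \ algValuedIn ι Φ.1 = {χ₀} := by
    ext χ
    rw [Set.mem_sdiff, mem_algValuedIn_iff, mem_algValuedIn_iff, ← Set.mem_sdiff, hdiff, Set.mem_singleton_iff,
      Set.mem_singleton_iff, ← hχ₀]
    exact (comp_algHom_injective ι).eq_iff
  have hχ₀E : χ₀ ∈ algValuedIn ι Φ₀.1 := by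
    rw [mem_algValuedIn_iff, hχ₀, hΦ₀]
    exact (conjugate_comp_ringHom (algebraMap k₀ K) σ₀).symm
  have hE₀card : (algValuedIn ι Φ₀.1).ncard = finrank ℚ K / 2 := by
    rw [ncard_algValuedIn j ι]
    have := two_mul_ncard_cmType_eq_finrank Φ₀
    omega
  rw [hcrit, hsing, h₀.typeRank_stabilizer_singleton hG hχ₀E, hE₀card]

/-- **A CM type with a special element is NONDEGENERATE** (`[K : ℚ] ≥ 6`). [cite: Dodson1984, §3.1.1 Theorem]
[cite: Howard2012, §3.1] -/
theorem isNondegenerate_of_special (hk₀ : finrank ℚ k₀ = 2) (h6 : 6 ≤ finrank ℚ K) {Φ : CMType K} {σ₀ : K →+* ℂ}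
    (hσ₀ : σ₀ ∈ Φ.1) (hsp : ∀ φ ∈ Φ.1, φ.comp (algebraMap k₀ K) = σ₀.comp (algebraMap k₀ K) → φ = σ₀) :
    IsNondegenerate Φ :=
  (isNondegenerate_iff Φ).2 (cmTypeRank_eq_of_special k₀ hk₀ h6 hσ₀ hsp)

/-- Every member of the Galois class of a type with a special element is nondegenerate (the class consists of the
types with a special element, g25-#6). [cite: Dodson1984, §3.1.1 Theorem] [cite: Howard2012, §3.1] -/
theorem isNondegenerate_of_exists_special (hk₀ : finrank ℚ k₀ = 2) (h6 : 6 ≤ finrank ℚ K) {Φ : CMType K}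
    (h : ∃ σ₀ : K →+* ℂ, σ₀ ∈ Φ.1 ∧ ∀ φ ∈ Φ.1, φ.comp (algebraMap k₀ K) = σ₀.comp (algebraMap k₀ K) → φ = σ₀) :
    IsNondegenerate Φ := by
  obtain ⟨σ₀, hσ₀, hsp⟩ := h
  exact isNondegenerate_of_special k₀ hk₀ h6 hσ₀ hsp

/-- **OCTIC `K ⊇ k₀`: a type with a special element (signature `(3, 1)`) has rank `5`** (nondegenerate; g25-#6 left
`Rank ∈ {4, 5}` from the reflex degree `8` alone). [cite: Dodson1984, §3.1.1 Theorem and §5.2] [cite: Howard2012, §3.1] -/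
theorem cmTypeRank_eq_five_of_special_octic (hk₀ : finrank ℚ k₀ = 2) (h8 : finrank ℚ K = 8) {Φ : CMType K}
    {σ₀ : K →+* ℂ} (hσ₀ : σ₀ ∈ Φ.1)
    (hsp : ∀ φ ∈ Φ.1, φ.comp (algebraMap k₀ K) = σ₀.comp (algebraMap k₀ K) → φ = σ₀) : cmTypeRank Φ = 5 := by
  rw [cmTypeRank_eq_of_special k₀ hk₀ (by omega) hσ₀ hsp, h8]

/-- Sextic `K ⊇ k₀`: primitive ⟹ nondegenerate, re-derived through the special element (the tree's
`isNondegenerate_iff_isPrimitive_sextic` / Yanai in prime degree give it independently). [cite: Dodson1984, §3.1.1 Theorem and §5.1.2]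
[cite: DinaIonicaSijsling2022, §1.3 Props. 16 and 18] -/
theorem isNondegenerate_of_isPrimitive_sextic' (hk₀ : finrank ℚ k₀ = 2) (h6 : finrank ℚ K = 6) {Φ : CMType K}
    {φ₀ : K →+* ℂ} (hprim : IsPrimitive (ℂ ≃+* ℂ) Φ.1 φ₀) : IsNondegenerate Φ :=
  isNondegenerate_of_exists_special k₀ hk₀ (by omega) (exists_special_of_isPrimitive_sextic k₀ hk₀ h6 hprim)

end NumberField

/-! ## §3 The Hodge conjecture for all powers of CM abelian varieties of unitary signature `(n − 1, 1)` -/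

section Hodge

open Literature.AlgebraicGeometry.Motives (AbelianVariety CMType)
open Literature.AlgebraicGeometry.HodgeTheory
open Literature.AlgebraicGeometry.ComplexMultiplication (IsCMTypeRealisation)
open Literature.AlgebraicGeometry.Pohlmann1968 (IsNondegenerate)
open CategoryTheory CategoryTheory.Limits

variable {K : Type} [Field K] [NumberField K] [IsCMField K] (k₀ : IntermediateField ℚ K) [IsTotallyComplex k₀]
variable {Φ : CMType K} {A : AbelianVariety ℂ} {ιA : 𝓞 K →+* End A} {θ : K →+* Module.End ℂ (complexBetti A.X 1)}

/-- **THE HODGE CONJECTURE FOR EVERY POWER `Aⁿ` OF A CM ABELIAN VARIETY WHOSE CM TYPE HAS A SPECIAL ELEMENT over an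
imaginary quadratic subfield** (unitary signature `(n − 1, 1)`, `[K : ℚ] ≥ 6`) — unconditional: the type is
nondegenerate (`isNondegenerate_of_special`), and the tree's `IsNondegenerate.hodgeConjectureFor_pow` (Pohlmann, Hazama,
Murty: `Hdg(Aⁿ) = Div(Aⁿ)` for nondegenerate types). [cite: Dodson1984, §3.1.1 Theorem]
[cite: Gordon1999HodgeAVSurvey, Thm. 6.4 and §9.3] [cite: Howard2012, §3.1] -/
theorem hodgeConjectureFor_pow_of_special (hk₀ : finrank ℚ k₀ = 2) (h6 : 6 ≤ finrank ℚ K) {σ₀ : K →+* ℂ}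
    (hσ₀ : σ₀ ∈ Φ.1) (hsp : ∀ φ ∈ Φ.1, φ.comp (algebraMap k₀ K) = σ₀.comp (algebraMap k₀ K) → φ = σ₀)
    (hA : IsCMTypeRealisation Φ A ιA θ) (n : ℕ) :
    HodgeConjectureFor (⨁ fun _ : Fin n => A).dim (⨁ fun _ : Fin n => A).X :=
  (isNondegenerate_of_special k₀ hk₀ h6 hσ₀ hsp).hodgeConjectureFor_pow hA n

/-- **The Hodge conjecture for a CM abelian variety whose CM type has a special element** (`[K : ℚ] ≥ 6`),
`HodgeConjectureFor A.dim A.X`, unconditional. [cite: Dodson1984, §3.1.1 Theorem] [cite: Yanai1985, Remark (p. 172)]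
[cite: Howard2012, §3.1] -/
theorem hodgeConjectureFor_of_special (hk₀ : finrank ℚ k₀ = 2) (h6 : 6 ≤ finrank ℚ K) {σ₀ : K →+* ℂ}
    (hσ₀ : σ₀ ∈ Φ.1) (hsp : ∀ φ ∈ Φ.1, φ.comp (algebraMap k₀ K) = σ₀.comp (algebraMap k₀ K) → φ = σ₀)
    (hA : IsCMTypeRealisation Φ A ιA θ) : HodgeConjectureFor A.dim A.X :=
  (isNondegenerate_of_special k₀ hk₀ h6 hσ₀ hsp).hodgeConjectureFor hA

/-- Every Hodge class on every power of such an `A` is algebraic (the class-level form).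
[cite: Gordon1999HodgeAVSurvey, Thm. 6.4 and §9.3] [cite: Dodson1984, §3.1.1 Theorem] -/
theorem hodgeClasses_algebraic_pow_of_special (hk₀ : finrank ℚ k₀ = 2) (h6 : 6 ≤ finrank ℚ K) {σ₀ : K →+* ℂ}
    (hσ₀ : σ₀ ∈ Φ.1) (hsp : ∀ φ ∈ Φ.1, φ.comp (algebraMap k₀ K) = σ₀.comp (algebraMap k₀ K) → φ = σ₀)
    (hA : IsCMTypeRealisation Φ A ιA θ) (n m : ℕ) (c : complexBetti (⨁ fun _ : Fin n => A).X (2 * m))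
    (hc : IsRationalClass c) (hmm : IsOfHodgeType (⨁ fun _ : Fin n => A).dim (⨁ fun _ : Fin n => A).X (2 * m) m m c) :
    c ∈ algebraicClasses (⨁ fun _ : Fin n => A).X m :=
  (isNondegenerate_of_special k₀ hk₀ h6 hσ₀ hsp).hodgeClasses_algebraic_pow hA n m c hc hmm

/-- **Sextic and octic CM fields with an imaginary quadratic subfield**: the Hodge conjecture for all powers of every
realisation of a PRIMITIVE type of a sextic such field (through its special element; also Yanai's prime-degree
theorem), and of every special type of an octic one. [cite: DinaIonicaSijsling2022, §1.3 Props. 16 and 18]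
[cite: Dodson1984, §3.1.1 Theorem] -/
theorem hodgeConjectureFor_pow_of_isPrimitive_sextic (hk₀ : finrank ℚ k₀ = 2) (h6 : finrank ℚ K = 6) {φ₀ : K →+* ℂ}
    (hprim : IsPrimitive (ℂ ≃+* ℂ) Φ.1 φ₀) (hA : IsCMTypeRealisation Φ A ιA θ) (n : ℕ) :
    HodgeConjectureFor (⨁ fun _ : Fin n => A).dim (⨁ fun _ : Fin n => A).X :=
  (isNondegenerate_of_isPrimitive_sextic' k₀ hk₀ h6 hprim).hodgeConjectureFor_pow hA n

end Hodge

end Literature.NumberTheory.ComplexMultiplication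

end
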